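import Literature.Probability.RandomPlanarGeometry.HexSAWBrickWallSlabFugacityInsertion
import Literature.Probability.RandomPlanarGeometry.HexSAWBrickWallStripMarginTheta
import HarnessLib

/-!
# Beaton 2014 Proposition 9 for every surface fugacity: `μ_H(y) < μ_{H+1}(y)` for all `y > 0` on the armchair slabs, with margin

Topic `Literature/Probability/RandomPlanarGeometry` (the leaf of the door «HEX-SLAB-STRICT-Y»:
`HexSAWBrickWallSlabFugacityInsertion.lean` — the weighted finite core
`Ĉ_{H,n}(y) xⁿ (1 + θ x^{2H+4})^{⌊n/(2(H+1))⌋} ≤ Σ_{m ≤ (2H+5)n} Ĉ_{H+1,m}(y) x^m`, `θ = min 1 (y²)` — and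
`HexSAWBrickWallSlabFugacity.lean` — `μ_H(y) = HexBW.slabMuY H y`; the lattice-free `θ`-extraction lemma
`MarginExtraction.log_margin_of_core_theta` is from `HexSAWBrickWallStripMarginTheta.lean`).  Source: N. R. Beaton,
*The critical surface fugacity of self-avoiding walks on a rotated honeycomb lattice*, J. Phys. A 47 (2014) 075003,
arXiv:1210.0274v3, §3.2, Proposition 9 (p. 15): "For `y > 0`, `μ_T(1,y) < μ_{T+1}(1,y)`. Moreover, as `T → ∞`,
`μ_T(1,y) → μ(y)`" — printed with "The proof is virtually identical to that of Proposition 7 in [BBdGDCG]" (the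
unfolded-arch factorisation of arXiv:1109.0358v5 pp. 11–12), i.e. proved by reference, without a rate, for the constant
weighted on one side, which equals the other-side constant by the bridge symmetry of Proposition 8 (p. 15: `μ_T(y,1) =
μ_T(1,y)`).  For the translation-class model of `HexSAWBrickWallSlabFugacity.lean` (weight on column `0`) the
identification with the printed constant is formal only at `y = 1` (`slabMuY_one` below); "`Slab_H`" is the lane's armchair
slab `{0 ≤ x₀ ≤ H}`, with no numerical identification with the printed strip width.  The tree had the case `y = 1`
(`HexBW.slabConnectiveConstant_lt_succ`, door R100, by the lane's double-row insertion); THIS file proves the strict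
inequality FOR EVERY `y > 0` (slabs `H ≥ 1`) by the same insertion, with the explicit margin below — a proof different from
the printed one.  Label (lane «pcv-sawmu», lit-1 gen 13): CONSOLIDATION BY A DIFFERENT PROOF; the explicit margin is not
in print.  The convergence part is not treated here.

## Statements (namespace `Literature.Probability.RandomPlanarGeometry.SAW.HexBW`, all PROVED, standard axioms)

* **`log_slabMuY_succ_sub_log_ge (hH : 1 ≤ H) (hy : 0 < y)`** —
  `log(1 + min(1,y²) μ_{H+1}(y)^{-(2H+4)}) / (2(H+1)) ≤ log μ_{H+1}(y) − log μ_H(y)`;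
* **`slabMuY_lt_succ (hH : 1 ≤ H) (hy : 0 < y)`** — `μ_H(y) < μ_{H+1}(y)` (Proposition 9, strict part, every `y > 0`).
-/

noncomputable section

open Filter Topology Finset Literature.Probability.LatticeModels Literature.Probability.Percolation

namespace Literature.Probability.RandomPlanarGeometry.SAW.HexBW

open MarginExtraction

/-- **Proposition 9 of Beaton 2014, strict part, FOR EVERY `y > 0`, WITH MARGIN** (armchair slabs `H ≥ 1`):
`log(1 + min(1,y²) · μ_{H+1}(y)^{-(2H+4)}) / (2(H+1)) ≤ log μ_{H+1}(y) − log μ_H(y)`.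
[cite: Beaton2014RotatedHoneycomb, §3.2, Proposition 9 (arXiv:1210.0274v3 p. 15: μ_T(1,y) < μ_{T+1}(1,y)) with Proposition 8 (p. 15: μ_T(y,1) = μ_T(1,y)); printed without a rate — the explicit margin and the insertion proof are the lane's] -/
theorem log_slabMuY_succ_sub_log_ge {H : ℕ} (hH : 1 ≤ H) {y : ℝ} (hy : 0 < y) :
    Real.log (1 + min 1 (y ^ 2) * slabMuY (H + 1) y ^ (-(2 * (H : ℝ) + 4))) / (2 * ((H : ℝ) + 1)) ≤
      Real.log (slabMuY (H + 1) y) - Real.log (slabMuY H y) := by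
  have hK := one_le_yK y
  have hK0 : 0 < yK y := by linarith
  have hμpos := slabMuY_pos hH hy
  have hθ0 : 0 ≤ min 1 (y ^ 2) := le_min zero_le_one (pow_nonneg hy.le 2)
  have hH1 : 1 ≤ H + 1 := by omega
  have hx := log_margin_of_core_theta (E := 2 * H + 4) (L := 2 * H + 1) (K := 2 * H + 5)
    (C := fun m => slabZ (H + 1) m y) (B := yK y) hμpos (one_le_slabMuY (by omega) hy) hK0.le hθ0
    (fun m => (slabZ_pos hH1 m hy).le) (tendsto_slabZ_rpow hH1 hy)
    fun n x hx0 hx1 => by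
      have e : n / (2 * H + 1 + 1) = n / (2 * (H + 1)) := by congr 1
      rw [e]
      have hpow := pow_slabMuY_le hH n hy hμpos.le
      have hcore := slab_weighted_core H n hx0 hx1 hy
      have hb : 0 ≤ (1 + min 1 (y ^ 2) * x ^ (2 * H + 4)) ^ (n / (2 * (H + 1))) :=
        pow_nonneg (by nlinarith [pow_nonneg hx0.le (2 * H + 4)]) _
      calc slabMuY H y ^ n * x ^ n * (1 + min 1 (y ^ 2) * x ^ (2 * H + 4)) ^ (n / (2 * (H + 1)))
          ≤ (yK y * slabZ H n y) * x ^ n * (1 + min 1 (y ^ 2) * x ^ (2 * H + 4)) ^ (n / (2 * (H + 1))) :=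
            mul_le_mul_of_nonneg_right (mul_le_mul_of_nonneg_right hpow (pow_nonneg hx0.le n)) hb
        _ = yK y * (slabZ H n y * x ^ n * (1 + min 1 (y ^ 2) * x ^ (2 * H + 4)) ^ (n / (2 * (H + 1)))) := by ring
        _ ≤ yK y * ∑ m ∈ Finset.range ((2 * H + 5) * n + 1), slabZ (H + 1) m y * x ^ m :=
            mul_le_mul_of_nonneg_left hcore hK0.le
  have e1 : ((2 * H + 4 : ℕ) : ℝ) = 2 * (H : ℝ) + 4 := by push_cast; ring
  have e2 : ((2 * H + 1 : ℕ) : ℝ) + 1 = 2 * ((H : ℝ) + 1) := by push_cast; ring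
  rwa [e1, e2] at hx

/-- **Proposition 9 of Beaton 2014 (strict part) for every `y > 0`**: `μ_H(y) < μ_{H+1}(y)` for the armchair slabs
`Slab_H`, `H ≥ 1`, with the surface fugacity `y` on the boundary column.
[cite: Beaton2014RotatedHoneycomb, §3.2, Proposition 9 (arXiv:1210.0274v3 p. 15: "For y > 0, μ_T(1,y) < μ_{T+1}(1,y)") with Proposition 8 (p. 15: μ_T(y,1) = μ_T(1,y)); not the proof formalised]
[cite: BeatonBousquetMelouDeGierDuminilCopinGuttmann2014, Proposition 7 (arXiv v5 p. 11) — the proof Beaton refers to] -/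
theorem slabMuY_lt_succ {H : ℕ} (hH : 1 ≤ H) {y : ℝ} (hy : 0 < y) : slabMuY H y < slabMuY (H + 1) y := by
  have hm := log_slabMuY_succ_sub_log_ge hH hy
  have hμ := slabMuY_pos (by omega : 1 ≤ H + 1) hy
  have hθ : 0 < min 1 (y ^ 2) := lt_min one_pos (pow_pos hy 2)
  have hpos : 0 < Real.log (1 + min 1 (y ^ 2) * slabMuY (H + 1) y ^ (-(2 * (H : ℝ) + 4))) / (2 * ((H : ℝ) + 1)) :=
    div_pos (Real.log_pos (by nlinarith [Real.rpow_pos_of_pos hμ (-(2 * (H : ℝ) + 4))])) (by positivity)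
  have : Real.log (slabMuY H y) < Real.log (slabMuY (H + 1) y) := by linarith
  exact (Real.log_lt_log_iff (slabMuY_pos hH hy) hμ).1 this


/-- At `y = 1` the weighted partition function is the slab count: `Ĉ_{H,n}(1) = c_n(Slab_H)`.
[cite: Beaton2014RotatedHoneycomb, §3.2, Proposition 8 (arXiv:1210.0274v3 p. 15)] -/
theorem slabZ_one (H n : ℕ) : slabZ H n 1 = (slabCount H n : ℝ) := by
  simp [slabZ, slabCount]

/-- **Consistency with the case `y = 1` of the tree**: `μ_H(1) = μ(Slab_H)` (`HexBW.slabConnectiveConstant`), so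
`slabMuY_lt_succ hH one_pos` is a second proof of `HexBW.slabConnectiveConstant_lt_succ hH`.
[cite: Beaton2014RotatedHoneycomb, §3.2, Proposition 9 (arXiv:1210.0274v3 p. 15; the case y = 1)] -/
theorem slabMuY_one (H : ℕ) : slabMuY H 1 = slabConnectiveConstant H := by
  unfold slabMuY slabConnectiveConstant
  have hK : yK 1 = 1 := by simp [yK]
  simp_rw [hK, slabZ_one, one_mul]

end Literature.Probability.RandomPlanarGeometry.SAW.HexBW
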